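import Mathlib.Analysis.SpecialFunctions.Complex.LogBounds
import Mathlib.Analysis.Asymptotics.AsymptoticEquivalent
import Mathlib.Analysis.Analytic.Order
import Mathlib.Analysis.Calculus.IteratedDeriv.Defs
import Mathlib.NumberTheory.Harmonic.EulerMascheroni
import Mathlib.NumberTheory.SmoothNumbers
import Mathlib.Topology.Algebra.InfiniteSum.Basic
import HarnessLib

/-!
# Partial Euler products on the critical line (Conrad 2005, §§2–5, over `ℚ`)

Topic `Literature/NumberTheory/LFunctions` (trunk T-ANT). The framework of K. Conrad, *Partial
Euler products on the critical line*, Canad. J. Math. **57** (2005) 267–297, restricted to the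
base field `K = ℚ`, together with the three results of §3 and §5 of that paper which make up the
printed proof of Goldfeld's theorem (Conrad, Cor. 5.7 = Thm. 1.1; Goldfeld, C. R. Acad. Sci. Paris
294 (1982) 471–474): *if the original Birch–Swinnerton-Dyer asymptotic
`∏_{p ≤ x} #E_ns(𝔽_p)/p ∼ C (log x)^r` holds, then `L(E, s) ≠ 0` on `Re s > 1` and
`r = ord_{s=1} L(E, s)`* (the tree's named fact `Literature.NumberTheory.EllipticCurves.analyticRank_eq_of_isEquivalent_prod`,
`Literature.NumberTheory.EllipticCurves.BSDAnalyticRank`). This file is the first layer of the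
decomposition of that fact (fact-owner's NOTES): the general, curve-free analysis.

## The setting (Conrad §2, (2.1), `K = ℚ`)

A *normalized Euler product over `ℚ` of degree at most `d`* is
`L(s) = ∏_p ∏_{j < d} (1 - α_{p,j} p^{-s})⁻¹` with `|α_{p,j}| ≤ 1`; it converges absolutely and is
nonvanishing on `Re s > 1`, and `Re s = 1/2` is "the critical line" (the `L`-function of an
elliptic curve `E / ℚ` fits after the shift `L(E, s + 1/2)`, with `α_{p,1} α_{p,2} = 1`,
`α_{p,1} + α_{p,2} = a_p / √p` at good `p`). We encode the datum as `α : ℕ → Fin d → ℂ` (only the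
values at primes matter) and define

* `IsNormalized α` — `‖α p j‖ ≤ 1` at every prime (Conrad (2.1));
* the primes `p ≤ x` are Mathlib's `Nat.primesLE ⌊x⌋₊` (the BSD fact writes the same finset as
  `(Finset.Iic ⌊x⌋₊).filter Nat.Prime`, see `filter_prime_Iic_eq_primesLE`);
* `partialProduct α s x = ∏_{p ≤ x} ∏_j (1 - α_{p,j} p^{-s})⁻¹` (a *partial Euler product*, §2);
* `logEulerFactor α s p = ∑_j -log (1 - α_{p,j} p^{-s})` (principal branch; for `|α p^{-s}| < 1`
  this is Conrad's `∑_{k ≥ 1} (α_{p,1}^k + ⋯ + α_{p,d}^k)/(k p^{ks})`, see `logEulerFactor_eq_tsum`),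
  and `logPartialProduct α s x = ∑_{p ≤ x} logEulerFactor α s p` — the "double sum" `∑_{p ≤ x} ∑_k`
  of Lemma 3.1;
* `logCoeff α n` — the Dirichlet coefficients `b_n` of `log L(s)`: `b_{p^k} = ∑_j α_{p,j}^k / k`,
  `b_n = 0` otherwise ((3.1) and the proof of Thm. 5.3), and
  `logPartialSum α s x = ∑_{n ≤ x} b_n n^{-s}` — the "single sum" `∑_{p^k ≤ x}` of Lemma 3.1;
* `eulerProduct α s = ∏'_p ∏_j (1 - α_{p,j} p^{-s})⁻¹` — `L(s)` itself (`Re s > 1`).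

## The named facts (cited, not proved here)

* `Conrad2005_lemma_3_1` — Lemma 3.1: for `Re s ≥ 1/2` the double sum equals the single sum plus
  `∑_{√x < p ≤ x} (α_{p,1}² + ⋯ + α_{p,d}²)/(2 p^{2s}) + o(1)`, and the middle sum is `o(1)` when
  `Re s > 1/2`;
* `Conrad2005_lemma_3_2` — Lemma 3.2: `∏_{p ≤ x} ∏_i (1 - γ_{p,i})⁻¹ ∼ C/(log x)^r` iff
  `-∑_{p ≤ x} ∑_i log(1 - γ_{p,i}) = -r log log x + C' + o(1)` for some `C'` with `e^{C'} = C`;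
* `Conrad2005_thm_5_3` — Theorem 5.3: if `∑_{p^k ≤ x} (α_{p,1}^k + ⋯)/(k p^{k/2})
  = -r log log x + C' + o(1)` then `L(s)` extends to a holomorphic nonvanishing function on
  `Re s > 1/2`, `L(s) ∼ e^{C'} e^{rγ} (s - 1/2)^r` as `s → 1/2⁺`, and if `L` is holomorphic at
  `1/2` its order of vanishing there is `r` with leading Taylor coefficient `e^{C'} e^{rγ}`.

Goldfeld's theorem is then "Cor. 4.11 + Thm. 5.3 applied to `L(E, s + 1/2)`" (Conrad, proof of
Cor. 5.7, p. 281); Cor. 4.11 needs Thm. 4.9 and the *second moment hypothesis* (Def. 4.4; for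
`E / ℚ` a theorem of Shimura, Example 4.7), which only govern the constant `√2` in Goldfeld's
`C = L^{(r)}(E,1)/(r! √2 e^{rγ})` and are not vendored here: the BSD fact of the tree does not
state the constant, and for it the `O(1)`-forms of Lemma 3.1 and of the proof of Thm. 5.3 suffice
(fact-owner's NOTES; those forms are to be *proved* in the sibling `…Proofs` file).

## Proved API

`logEulerFactor_eq_tsum` (the `k`-series form of one factor), `exp_logEulerFactor`,
`exp_logPartialProduct` (`exp` of the double sum is the partial product),
`norm_mul_cpow_neg_le` (`‖α p^{-s}‖ ≤ p^{-Re s} ≤ 2^{-Re s}`).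

## References

* K. Conrad, *Partial Euler products on the critical line*, Canad. J. Math. 57 (2005) 267–297,
  §2 (2.1)–(2.2), §3 Lemma 3.1, Lemma 3.2, Thm. 3.3, §5 Lemma 5.1, 5.2, Thm. 5.3, Cor. 5.7.
  [cite: Conrad2005PartialEuler]
* D. Goldfeld, *Sur les produits partiels eulériens attachés aux courbes elliptiques*, C. R.
  Acad. Sci. Paris Sér. I 294 (1982) 471–474. [cite: Goldfeld1982]

## Design

* `K = ℚ` only (primes `p : ℕ`, `Np = p`): this is the generality the BSD fact needs; Conrad's
  number-field version would index by `HeightOneSpectrum (𝓞 K)` ordered by norm.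
* Asymptotics are over the real variable `x → ∞` (`Filter.atTop` on `ℝ`) with the primes
  `Nat.primesLE ⌊x⌋₊` (the finset of `Literature.NumberTheory.EllipticCurves.analyticRank_eq_of_isEquivalent_prod`, which writes it
  `(Finset.Iic ⌊x⌋₊).filter Nat.Prime`); `o(1)` is `Tendsto … (𝓝 0)`,
  `(log x)^r` for complex `r` is the principal power `((Real.log x : ℝ) : ℂ) ^ r`.
* "`L` extends to a holomorphic function `G` on `Re s > 1/2`" is an existential over `G : ℂ → ℂ`
  with `DifferentiableOn` and agreement with `eulerProduct α` on `Re s > 1`; "`L` is holomorphic at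
  `1/2`" is an `H` analytic at `1/2` agreeing with `G` on a right half-neighbourhood of `1/2`.
-/

noncomputable section

open scoped Topology
open Filter Asymptotics Complex Finset

namespace Literature.NumberTheory.LFunctions

namespace PartialEuler

variable {d : ℕ}

/-! ### The datum and the basic finite objects -/

/-- A datum `α : ℕ → Fin d → ℂ` is *normalized* if `|α_{p,j}| ≤ 1` for every prime `p` and every
`j` (Conrad 2005, §2, display (2.1): "where `|α_{p,1}|, …, |α_{p,d}| ≤ 1`").
[cite: Conrad2005PartialEuler, §2 (2.1)] -/
def IsNormalized (α : ℕ → Fin d → ℂ) : Prop :=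
  ∀ p : ℕ, p.Prime → ∀ j : Fin d, ‖α p j‖ ≤ 1

/-- Bridge to the literal finset of the BSD fact `Literature.NumberTheory.EllipticCurves.analyticRank_eq_of_isEquivalent_prod`:
`(Finset.Iic N).filter Nat.Prime = Nat.primesLE N` (Mathlib's `Nat.primesLE N` is the filter of
`Finset.range (N + 1)`); used with `N = ⌊x⌋₊`. [folklore] -/
theorem filter_prime_Iic_eq_primesLE (N : ℕ) : (Finset.Iic N).filter Nat.Prime = Nat.primesLE N := by
  ext p
  simp [Nat.mem_primesLE]

/-- The *partial Euler product* `∏_{p ≤ x} ∏_j (1 - α_{p,j} p^{-s})⁻¹` of a degree-`≤ d` Euler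
product over `ℚ` (Conrad 2005, §2: "Any finite product `∏_{Np ≤ x} …` taken over `p` with norm up
to some bound `x`, will be called a partial Euler product for `L(s)`").
[cite: Conrad2005PartialEuler, §2] -/
def partialProduct (α : ℕ → Fin d → ℂ) (s : ℂ) (x : ℝ) : ℂ :=
  ∏ p ∈ Nat.primesLE ⌊x⌋₊, ∏ j, (1 - α p j * (p : ℂ) ^ (-s))⁻¹

/-- The logarithm of one Euler factor, `∑_j -log (1 - α_{p,j} p^{-s})` (principal branch). For
`|α_{p,j} p^{-s}| < 1` this is the `k`-series `∑_{k ≥ 1} (α_{p,1}^k + ⋯ + α_{p,d}^k)/(k p^{ks})` of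
Conrad (3.1) (`logEulerFactor_eq_tsum`). [cite: Conrad2005PartialEuler, §3 (3.1)] -/
def logEulerFactor (α : ℕ → Fin d → ℂ) (s : ℂ) (p : ℕ) : ℂ :=
  ∑ j, -log (1 - α p j * (p : ℂ) ^ (-s))

/-- The *double sum* `∑_{p ≤ x} ∑_{k ≥ 1} (α_{p,1}^k + ⋯ + α_{p,d}^k)/(k p^{ks})` of Conrad's
Lemma 3.1, i.e. the logarithm `∑_{p ≤ x} ∑_j -log(1 - α_{p,j} p^{-s})` of the partial Euler product
(`exp_logPartialProduct`). [cite: Conrad2005PartialEuler, §3 (3.1) and Lemma 3.1] -/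
def logPartialProduct (α : ℕ → Fin d → ℂ) (s : ℂ) (x : ℝ) : ℂ :=
  ∑ p ∈ Nat.primesLE ⌊x⌋₊, logEulerFactor α s p

/-- The Dirichlet coefficients `b_n` of `log L(s) = ∑ b_n n^{-s}`: `b_{p^k} = (α_{p,1}^k + ⋯ +
α_{p,d}^k)/k` at a prime power `n = p^k` (`k ≥ 1`), `b_n = 0` otherwise (Conrad (3.1) and the proof
of Thm. 5.3: "Set `b_n = ∑_{Np^k = n} (α_{p,1}^k + ⋯ + α_{p,d}^k)/k`, so `log L(s) = ∑ b_n n^{-s}` for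
`Re(s) > 1`"). Here `p = n.minFac` and `k = n.factorization p`.
[cite: Conrad2005PartialEuler, §3 (3.1) and proof of Thm. 5.3] -/
def logCoeff (α : ℕ → Fin d → ℂ) (n : ℕ) : ℂ :=
  if IsPrimePow n then
    (∑ j, α n.minFac j ^ n.factorization n.minFac) / (n.factorization n.minFac : ℂ)
  else 0

/-- The *single sum* `∑_{p^k ≤ x} (α_{p,1}^k + ⋯ + α_{p,d}^k)/(k p^{ks}) = ∑_{n ≤ x} b_n n^{-s}` of
Conrad's Lemma 3.1 / (5.1) (prime powers ordered by size).
[cite: Conrad2005PartialEuler, Lemma 3.1 and (5.1)] -/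
def logPartialSum (α : ℕ → Fin d → ℂ) (s : ℂ) (x : ℝ) : ℂ :=
  ∑ n ∈ Finset.Iic ⌊x⌋₊, logCoeff α n * (n : ℂ) ^ (-s)

/-- The Euler product `L(s) = ∏_p ∏_j (1 - α_{p,j} p^{-s})⁻¹` itself (Conrad (2.1)), as an
unconditional product over the primes; it converges (absolutely) for `Re s > 1` when `α` is
normalized, and is meant to be used only there. [cite: Conrad2005PartialEuler, §2 (2.1)] -/
def eulerProduct (α : ℕ → Fin d → ℂ) (s : ℂ) : ℂ :=
  ∏' p : Nat.Primes, ∏ j, (1 - α p j * ((p : ℕ) : ℂ) ^ (-s))⁻¹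

/-! ### Elementary API -/

section API

/-- `‖p^{-s}‖ = p^{-Re s}` for a prime (indeed any positive) `p`. [folklore] -/
theorem norm_natCast_cpow_neg {p : ℕ} (hp : 0 < p) (s : ℂ) :
    ‖(p : ℂ) ^ (-s)‖ = (p : ℝ) ^ (-s.re) := by
  rw [norm_natCast_cpow_of_pos hp, neg_re]

/-- For a normalized datum, `‖α_{p,j} p^{-s}‖ ≤ p^{-Re s}`. [folklore] -/
theorem norm_mul_cpow_neg_le {α : ℕ → Fin d → ℂ} (hα : IsNormalized α) {p : ℕ} (hp : p.Prime) (j : Fin d)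
    (s : ℂ) : ‖α p j * (p : ℂ) ^ (-s)‖ ≤ (p : ℝ) ^ (-s.re) := by
  rw [norm_mul, norm_natCast_cpow_neg hp.pos]
  exact mul_le_of_le_one_left (Real.rpow_nonneg (Nat.cast_nonneg _) _) (hα p hp j)

/-- `p^{-σ} ≤ 2^{-σ}` for a prime `p` and `σ ≥ 0`. [folklore] -/
theorem prime_rpow_neg_le_two_rpow_neg {p : ℕ} (hp : p.Prime) {σ : ℝ} (hσ : 0 ≤ σ) :
    (p : ℝ) ^ (-σ) ≤ (2 : ℝ) ^ (-σ) :=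
  Real.rpow_le_rpow_of_nonpos (by norm_num) (by exact_mod_cast hp.two_le) (neg_nonpos.mpr hσ)

/-- For a normalized datum and `Re s > 0`, `‖α_{p,j} p^{-s}‖ < 1`, so the principal logarithm of
the Euler factor is given by its Taylor series. [folklore] -/
theorem norm_mul_cpow_neg_lt_one {α : ℕ → Fin d → ℂ} (hα : IsNormalized α) {p : ℕ} (hp : p.Prime) (j : Fin d)
    {s : ℂ} (hs : 0 < s.re) : ‖α p j * (p : ℂ) ^ (-s)‖ < 1 := by
  refine (norm_mul_cpow_neg_le hα hp j s).trans_lt ?_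
  refine (prime_rpow_neg_le_two_rpow_neg hp hs.le).trans_lt ?_
  exact Real.rpow_lt_one_of_one_lt_of_neg (by norm_num) (neg_lt_zero.mpr hs)

/-- **The `k`-series form of one Euler factor** (Conrad (3.1)): for `Re s > 0` and a normalized
datum, `∑_j -log(1 - α_{p,j} p^{-s}) = ∑_{k ≥ 1} (α_{p,1}^k + ⋯ + α_{p,d}^k) p^{-ks} / k`
(the term `k = 0` of the `ℕ`-indexed series is `0`). [cite: Conrad2005PartialEuler, §3 (3.1)] -/
theorem logEulerFactor_eq_tsum {α : ℕ → Fin d → ℂ} (hα : IsNormalized α) {p : ℕ} (hp : p.Prime) {s : ℂ}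
    (hs : 0 < s.re) :
    HasSum (fun k : ℕ => (∑ j, (α p j * (p : ℂ) ^ (-s)) ^ k) / k) (logEulerFactor α s p) := by
  unfold logEulerFactor
  have h := fun j : Fin d =>
    Complex.hasSum_taylorSeries_neg_log (norm_mul_cpow_neg_lt_one hα hp j hs)
  have := hasSum_sum (s := (Finset.univ : Finset (Fin d))) fun j _ => h j
  refine this.congr_fun fun k => ?_
  rw [Finset.sum_div]

/-- `exp` of the logarithm of one Euler factor is the factor: `exp (∑_j -log(1 - α_{p,j} p^{-s}))
= ∏_j (1 - α_{p,j} p^{-s})⁻¹`, provided no `α_{p,j} p^{-s}` equals `1` (e.g. `Re s > 0` and `α`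
normalized). [folklore] -/
theorem exp_logEulerFactor (α : ℕ → Fin d → ℂ) {p : ℕ} {s : ℂ} (h : ∀ j, α p j * (p : ℂ) ^ (-s) ≠ 1) :
    exp (logEulerFactor α s p) = ∏ j, (1 - α p j * (p : ℂ) ^ (-s))⁻¹ := by
  rw [logEulerFactor, exp_sum]
  refine Finset.prod_congr rfl fun j _ => ?_
  rw [exp_neg, exp_log]
  exact sub_ne_zero.mpr (h j).symm

/-- `exp` of the double sum is the partial Euler product:
`exp (∑_{p ≤ x} ∑_j -log(1 - α_{p,j} p^{-s})) = ∏_{p ≤ x} ∏_j (1 - α_{p,j} p^{-s})⁻¹`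
(for `Re s > 0` and `α` normalized). [folklore] -/
theorem exp_logPartialProduct {α : ℕ → Fin d → ℂ} (hα : IsNormalized α) {s : ℂ} (hs : 0 < s.re) (x : ℝ) :
    exp (logPartialProduct α s x) = partialProduct α s x := by
  rw [logPartialProduct, exp_sum, partialProduct]
  refine Finset.prod_congr rfl fun p hp => exp_logEulerFactor α fun j h1 => ?_
  have := norm_mul_cpow_neg_lt_one hα (Nat.prime_of_mem_primesLE hp) j hs
  rw [h1, norm_one] at this
  exact lt_irrefl _ this

/-- The logarithmic coefficient at a prime power: `b_{p^k} = (∑_j α_{p,j}^k)/k` for `k ≥ 1`.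
[cite: Conrad2005PartialEuler, §3 (3.1)] -/
theorem logCoeff_prime_pow (α : ℕ → Fin d → ℂ) {p k : ℕ} (hp : p.Prime) (hk : k ≠ 0) :
    logCoeff α (p ^ k) = (∑ j, α p j ^ k) / (k : ℂ) := by
  have hpp : IsPrimePow (p ^ k) := (hp.prime.isPrimePow).pow hk
  rw [logCoeff, if_pos hpp, hp.pow_minFac hk, Nat.Prime.factorization_pow hp]
  simp

/-- The logarithmic coefficient vanishes off the prime powers. [folklore] -/
theorem logCoeff_of_not_isPrimePow (α : ℕ → Fin d → ℂ) {n : ℕ} (hn : ¬ IsPrimePow n) : logCoeff α n = 0 :=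
  if_neg hn

end API

/-! ### Conrad's Lemma 3.1, Lemma 3.2 and Theorem 5.3 (named facts) -/

/-- **Conrad 2005, Lemma 3.1** (over `ℚ`). Let `α` be normalized of degree `≤ d`. For each `s`
with `Re(s) ≥ 1/2`,
`∑_{p ≤ x} ∑_{k ≥ 1} (α_{p,1}^k + ⋯ + α_{p,d}^k)/(k p^{ks})
  = ∑_{p^k ≤ x} (α_{p,1}^k + ⋯ + α_{p,d}^k)/(k p^{ks}) + ∑_{√x < p ≤ x} (α_{p,1}² + ⋯ + α_{p,d}²)/(2 p^{2s}) + o(1)`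
as `x → ∞`; and when `Re(s) > 1/2` the second sum on the right is `o(1)` as `x → ∞`. (The left
side is `logPartialProduct`, by `logEulerFactor_eq_tsum`; the first sum on the right is
`logPartialSum`.) [cite: Conrad2005PartialEuler, Lemma 3.1] -/
def Conrad2005_lemma_3_1 : Prop :=
  ∀ (d : ℕ) (α : ℕ → Fin d → ℂ), IsNormalized α → ∀ s : ℂ, (1 / 2 : ℝ) ≤ s.re →
    Tendsto (fun x : ℝ => logPartialProduct α s x - logPartialSum α s x -
      ∑ p ∈ (Nat.primesLE ⌊x⌋₊).filter (fun p : ℕ => Real.sqrt x < p),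
        (∑ j, α p j ^ 2) / (2 * (p : ℂ) ^ (2 * s))) atTop (𝓝 0) ∧
    ((1 / 2 : ℝ) < s.re →
      Tendsto (fun x : ℝ => ∑ p ∈ (Nat.primesLE ⌊x⌋₊).filter (fun p : ℕ => Real.sqrt x < p),
        (∑ j, α p j ^ 2) / (2 * (p : ℂ) ^ (2 * s))) atTop (𝓝 0))

/-- **Conrad 2005, Lemma 3.2** (over `ℚ`). Fix `d ≥ 1`. For each prime `p` let
`γ_{p,1}, …, γ_{p,d}` be complex numbers in the open unit disc with `max_i |γ_{p,i}| → 0` as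
`p → ∞` (equivalently `∑_i |γ_{p,i}| → 0` along the cofinite filter on the primes). Then the asymptotic relation `∏_{p ≤ x} ((1 - γ_{p,1}) ⋯ (1 - γ_{p,d}))⁻¹ ∼ C/(log x)^r`
(`x → ∞`), for some `C ∈ ℂˣ` and `r ∈ ℂ`, is equivalent to
`-∑_{p ≤ x} (log(1 - γ_{p,1}) + ⋯ + log(1 - γ_{p,d})) = -r log log x + C' + o(1)` for some `C'`
with `e^{C'} = C` (principal branch of `log`). [cite: Conrad2005PartialEuler, Lemma 3.2] -/
def Conrad2005_lemma_3_2 : Prop :=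
  ∀ (d : ℕ), 1 ≤ d → ∀ (γ : ℕ → Fin d → ℂ), (∀ p : ℕ, p.Prime → ∀ i, ‖γ p i‖ < 1) →
    Tendsto (fun p : Nat.Primes => ∑ i, ‖γ p i‖) cofinite (𝓝 0) →
    ∀ (C : ℂ), C ≠ 0 → ∀ (r : ℂ),
      ((fun x : ℝ => ∏ p ∈ Nat.primesLE ⌊x⌋₊, ∏ i, (1 - γ p i)⁻¹) ~[atTop]
          fun x : ℝ => C / ((Real.log x : ℝ) : ℂ) ^ r) ↔
      ∃ C' : ℂ, exp C' = C ∧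
        Tendsto (fun x : ℝ => -(∑ p ∈ Nat.primesLE ⌊x⌋₊, ∑ i, log (1 - γ p i)) -
          (-r * log ((Real.log x : ℝ) : ℂ) + C')) atTop (𝓝 0)

/-- **Conrad 2005, Theorem 5.3** (over `ℚ`). Let `L(s)` be a normalized Euler product of degree
`≤ d` as in (2.1). If
`∑_{p^k ≤ x} (α_{p,1}^k + ⋯ + α_{p,d}^k)/(k p^{k/2}) = -r log log x + C' + o(1)`  (5.1)
as `x → ∞`, for some `C'` and `r` in `ℂ`, then `L(s)` extends to a holomorphic nonvanishing
function on `Re(s) > 1/2` (here: some `G`, complex differentiable on the open half-plane, equal to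
the Euler product on `Re(s) > 1`, without zeros), and `L(s) ∼ e^{C'} e^{rγ} (s - 1/2)^r` as
`s → 1/2⁺` (along the reals)  (5.2). If `L(s)` is holomorphic at `s = 1/2` (some `H` analytic at
`1/2` agrees with `G` on a right half-neighbourhood of `1/2`), then the order of vanishing there is
`r` and its leading Taylor coefficient is `e^{C'} e^{rγ}`. Here `γ` is Euler's constant.
[cite: Conrad2005PartialEuler, Thm. 5.3] -/
def Conrad2005_thm_5_3 : Prop :=
  ∀ (d : ℕ) (α : ℕ → Fin d → ℂ), IsNormalized α → ∀ (r C' : ℂ),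
    Tendsto (fun x : ℝ => logPartialSum α (1 / 2) x -
      (-r * log ((Real.log x : ℝ) : ℂ) + C')) atTop (𝓝 0) →
    ∃ G : ℂ → ℂ, DifferentiableOn ℂ G {s : ℂ | 1 / 2 < s.re} ∧
      (∀ s : ℂ, 1 < s.re → G s = eulerProduct α s) ∧
      (∀ s : ℂ, 1 / 2 < s.re → G s ≠ 0) ∧
      ((fun σ : ℝ => G σ) ~[𝓝[>] (1 / 2 : ℝ)] fun σ : ℝ =>
        exp C' * exp (r * (Real.eulerMascheroniConstant : ℂ)) * ((σ - 1 / 2 : ℝ) : ℂ) ^ r) ∧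
      (∀ H : ℂ → ℂ, AnalyticAt ℂ H (1 / 2 : ℂ) →
        (∀ᶠ s in 𝓝[{s : ℂ | 1 / 2 < s.re}] (1 / 2 : ℂ), H s = G s) →
        ∃ m : ℕ, (m : ℂ) = r ∧ analyticOrderAt H (1 / 2 : ℂ) = m ∧
          iteratedDeriv m H (1 / 2 : ℂ) / (m.factorial : ℂ) =
            exp C' * exp (r * (Real.eulerMascheroniConstant : ℂ)))

end PartialEuler

end Literature.NumberTheory.LFunctions

end
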